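import Summits.BirchSwinnertonDyer.BirchSwinnertonDyer.Theorems.PrintCf2RubinValueTwoRestrictedMainConjLinePushOuter
import Summits.BirchSwinnertonDyer.BirchSwinnertonDyer.Theorems.PrintCf2RubinValueTwoRestrictedMainConjLinePushFrame
import Literature.NumberTheory.EllipticCurves.IwasawaAlgebraPseudoNullProofs
import Mathlib.RingTheory.QuotSMulTop
import HarnessLib

/-!
# Route C `PrintCf2RubinValueTwo`, crux `RestrictedMainConjWithValueAtTwo` (stmt-BirchSwinnertonDyer-23722), stub `stub_restrictedEven` —
# brick (RES) of the LEAD's TURNKEY-S3B-PUSH in its TARGET SHAPE: the `Λ`-linear control map `QuotSMulTop T₁ D₂.X →ₗ[Λ] D.X`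
# (`Λ` acting on the `γ₁`-coinvariants through `PowerSeries.C`, the `Module.compHom` of `charIdeal_le_map_constantCoeff_of_control`),
# with FINITE (hence pseudo-null) COKERNEL on every frame, and kernel = Pontryagin dual of the COKERNEL OF CONTROL — finite as soon as the
# control map is onto the `γ₁`-invariants up to finite index (the one displayed input left: local at `v̄` and away from `2`)

Cell `bsd-print-cf2`, width seat `bsd-line-cf2c-w8` g0 (prover-bsd-line-cf2c-w8-g0-0); `--supports stmt-BirchSwinnertonDyer-23722`. Sequel of
p682128 / p682650 / p683075 (`…LinePush`, `…LinePushFrame`, `…LinePushOuter`). HONEST FRAMING: nothing here closes the crux or the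
registered stub; BSD is not proved by any of this; no summit statement is proved by this seat. No definition, no named fact, no `sorry`.

WHAT (outer convention (R-SEAM): pair `(κ₁, κ₂; γ₁, γ₂)`, line `κ′ := κ₂`, `T₁ = PowerSeries.X` OUTER ↔ `γ₁`, `g` the control map of
`exists_lineRes_right`, `φ` its `constantCoeff`-semilinear transpose of `exists_transpose_right`):
* §1 (generic `p`, `K`, `M`) **`exists_linearMap_quotSMulTop`** — `φ` DESCENDS to `f : QuotSMulTop (X : Λ₂) D₂.X →ₗ[Λ] D.X` for the
  `compHom`-structure along `PowerSeries.C` (`transpose_right_X_smul`: `φ` kills `X • ⊤`; `transpose_right_C_smul`: `Λ`-linearity), with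
  `D.toDual (f [x]) t = D₂.toDual x (g t)` and `range f = range φ`; hence **`finite_coker_linearMap_quotSMulTop`** /
  **`isPseudoNull_coker_…`** (finite ⟹ pseudo-null over `Λ`, `isPseudoNull_of_finite`) from p683075 §3–§4.
* §2 THE KERNEL: **`finite_ker_linearMap_quotSMulTop_of_finite_coker_control`** — `ker f ↪ Hom(I ⧸ g(𝔖), ℚ/ℤ)`, `I = ker(conj_{γ₁} − 1)` the
  `γ₁`-invariants of `H¹_nr(K̃_∞, M)` (a class `[x] ∈ ker f` has `D₂.toDual x` vanishing on `g(𝔖)`; if it vanishes on all of `I` then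
  `x ∈ X • D₂.X` by `IwasawaTwoVariable.exists_comp_eq_of_forall_ker`, i.e. `[x] = 0`); so `#ker f ≤ #(I ⧸ g(𝔖))` and `ker f` is finite /
  pseudo-null whenever THE COKERNEL OF CONTROL `I ⧸ g(𝔖)` is finite — the single remaining (RES) input, displayed. EXACT control ⟹ `ker f = ⊥`.
* §3 (road α, p = 2, `κ₁` unramified outside `v`, `κ₂` unramified outside `v̄`, `M = W*`, any `π, r`, every member): the cokernel side needs
  no hypothesis (`W*(K̃_∞)` finite, p682650): **`exists_linearMap_quotSMulTop_of_frame`** — `f` exists with pseudo-null cokernel; and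
  **`restrictedDual_pseudoIso_quotSMulTop_of_frame_of_finite_coker_control`** — GIVEN `Finite (I ⧸ g(𝔖))`, `f` has pseudo-null kernel AND
  cokernel: the TURNKEY's `restrictedDual_pseudoIso_quotSMulTop_of_frame` modulo the cokernel of control.
presearch: Greenberg LNM 1716 §3 Lemmas 3.1–3.2 / §4; Agboola 2007 §3 Prop. 3.2, §4; Skinner–Urban 2014 Prop. 3.2.8, Cor. 3.2.9; JSW 2017 Cor.
3.4.2 — all held; tree assembly, no new fact. beyond-print theorem: no.

References: [GreenbergLNM1716] §3 L. 3.1–3.2; [Agboola2007] §3 Prop. 3.2, §4; [SkinnerUrban2014] §3.2.8–3.2.9; [JetchevSkinnerWan2017] Cor. 3.4.2.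
-/

noncomputable section

open scoped Classical Pointwise
-- the summit namespace `Summit.BirchSwinnertonDyer.BirchSwinnertonDyer` repeats the problem name by design (D-0017)
set_option linter.dupNamespace false
set_option autoImplicit false

open NumberField IsDedekindDomain Field WeierstrassCurve
open Literature.NumberTheory.EllipticCurves Literature.NumberTheory.EllipticCurves.GreenbergSelmer
open Literature.NumberTheory.EllipticCurves.Agboola2007
open Literature.NumberTheory.EllipticCurves.IwasawaDual
open Literature.NumberTheory.GaloisRepresentations
open Summit.BirchSwinnertonDyer.BirchSwinnertonDyer.Theorems.PrintCf2.RestrictedSelmerPair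

universe u

namespace Summit.BirchSwinnertonDyer.BirchSwinnertonDyer.Theorems.PrintCf2.LinePush

/-! ## §1. Descending the transpose to `QuotSMulTop T₁ D₂.X →ₗ[Λ] D.X` -/

section Generic

variable {K : Type u} [Field K] [NumberField K] {p : ℕ} [Fact p.Prime] {κ₁ κ₂ : ZpExtension K p}
  {M : Type u} [AddCommGroup M] [DistribMulAction (absoluteGaloisGroup K) M] [TopologicalSpace M] [DiscreteTopology M]
  {𝔮 : HeightOneSpectrum (𝓞 K)} {γ₁ γ₂ : absoluteGaloisGroup K}
  {g : restrictedSelmerZp κ₂ M 𝔮 →+ unrSelmer₂ κ₁ κ₂ M 𝔮}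
  (hg : ∀ t : restrictedSelmerZp κ₂ M 𝔮,
    ((g t : unrSelmer₂ κ₁ κ₂ M 𝔮) : subgroupH1 (ZpExtension.pairKer κ₁ κ₂) M) =
      resOfLe M (ZpExtension.pairKer_le_right κ₁ κ₂) (t : subgroupH1 κ₂.kerSubgroup M))
  {D₂ : DualData₂ κ₁ κ₂ M 𝔮 γ₁ γ₂} {D : RestrictedDualData κ₂ M 𝔮 γ₂}
  {φ : D₂.X →ₛₗ[PowerSeries.constantCoeff (R := IwasawaAlgebra p)] D.X}
  (hφ : ∀ (x : D₂.X) (t : restrictedSelmerZp κ₂ M 𝔮), D.toDual (φ x) t = D₂.toDual x (g t))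
include hg hφ

/-- `T₁ • ⊤ ≤ ker φ`: the transpose kills the `γ₁`-covariant part (`transpose_right_X_smul`). [cite: SkinnerUrban2014, Prop. 3.2.8 (p. 23)] -/
theorem X_smul_top_le_ker_transpose_right :
    (PowerSeries.X : IwasawaAlgebra₂ p) • (⊤ : Submodule (IwasawaAlgebra₂ p) D₂.X) ≤ LinearMap.ker φ := by
  have _ := hg
  intro x hx
  obtain ⟨y, -, rfl⟩ := (Submodule.mem_smul_pointwise_iff_exists _ _ _).mp hx
  exact transpose_right_X_smul hφ y

/-- **BRICK (RES), generic form: the `Λ`-LINEAR control map `f : QuotSMulTop T₁ D₂.X →ₗ[Λ] D.X` with its four properties.** For a generator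
pair `(κ₁, κ₂; γ₁, γ₂)`, a discrete `p`-primary `M` with open stabilisers and continuous orbits such that `M^{Gal(K̄/K̃_∞)}/(γ₁ − 1)` is finite,
ANY `D₂ : DualData₂ κ₁ κ₂ M 𝔮 γ₁ γ₂` and ANY `D : RestrictedDualData κ₂ M 𝔮 γ₂`: there is a `Λ`-linear
`f : D₂.X ⧸ T₁ D₂.X → D.X` — `Λ = ℤ_p⟦T⟧` acting on the `γ₁`-coinvariants `QuotSMulTop X D₂.X` through `PowerSeries.C` (the `Module.compHom`
of `charIdeal_le_map_constantCoeff_of_control`) — such that (i) `D.toDual (f [x]) t = D₂.toDual x (g t)` (transpose of control);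
(ii) its cokernel is FINITE with `# ≤ #(M^{Gal(K̄/K̃_∞)}/(γ₁ − 1))`; (iii) its kernel is FINITE with `# ≤ #(I ⧸ g(𝔖))`, `I = ker(conj_{γ₁} − 1)`
the `γ₁`-invariants of `H¹_nr(K̃_∞, M)`, AS SOON AS that cokernel of control is finite (`ker f ↪ Hom(I/g(𝔖), ℚ/ℤ)`: a class `[x]` with
`D₂.toDual x` vanishing on `g(𝔖)` AND on `I` lies in `T₁ D₂.X`, `IwasawaTwoVariable.exists_comp_eq_of_forall_ker`). The descent
(SP) then reads `ch_Λ(D.X) = ch_Λ(D₂.X/T₁)` by pseudo-isomorphism invariance. [cite: Agboola2007, §3 Prop. 3.2 and §4]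
[cite: SkinnerUrban2014, Prop. 3.2.8 and Cor. 3.2.9 (pp. 23–24)] [cite: GreenbergLNM1716, §3 Lemmas 3.1–3.2] -/
theorem exists_linearMap_quotSMulTop (hγ : ZpExtension.IsTopGeneratorPair κ₁ κ₂ γ₁ γ₂)
    (hcont : ∀ m : M, Continuous fun g : absoluteGaloisGroup K ↦ g • m)
    [Finite (FixedPoints.addSubgroup (ZpExtension.pairKer κ₁ κ₂) M ⧸ (ResKernel.subOne (ZpExtension.pairKer κ₁ κ₂) M γ₁).range)] :
    letI : Module (IwasawaAlgebra p) (QuotSMulTop (PowerSeries.X : IwasawaAlgebra₂ p) D₂.X) :=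
      Module.compHom _ (PowerSeries.C (R := IwasawaAlgebra p))
    ∃ f : QuotSMulTop (PowerSeries.X : IwasawaAlgebra₂ p) D₂.X →ₗ[IwasawaAlgebra p] D.X,
      (∀ (x : D₂.X) (t : restrictedSelmerZp κ₂ M 𝔮), D.toDual (f (Submodule.Quotient.mk x)) t = D₂.toDual x (g t)) ∧
      (Finite (D.X ⧸ LinearMap.range f) ∧ Nat.card (D.X ⧸ LinearMap.range f) ≤
        Nat.card (FixedPoints.addSubgroup (ZpExtension.pairKer κ₁ κ₂) M ⧸ (ResKernel.subOne (ZpExtension.pairKer κ₁ κ₂) M γ₁).range)) ∧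
      (Finite ((conjSel₂ κ₁ κ₂ M 𝔮 γ₁ - 1).ker ⧸ g.range.addSubgroupOf (conjSel₂ κ₁ κ₂ M 𝔮 γ₁ - 1).ker) →
        Finite (LinearMap.ker f) ∧ Nat.card (LinearMap.ker f) ≤
          Nat.card ((conjSel₂ κ₁ κ₂ M 𝔮 γ₁ - 1).ker ⧸ g.range.addSubgroupOf (conjSel₂ κ₁ κ₂ M 𝔮 γ₁ - 1).ker)) := by
  set r : IwasawaAlgebra₂ p := PowerSeries.X with hr
  letI inst : Module (IwasawaAlgebra p) (QuotSMulTop r D₂.X) := Module.compHom _ (PowerSeries.C (R := IwasawaAlgebra p))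
  -- the semilinear descent of `φ`
  let f₀ : QuotSMulTop r D₂.X →ₛₗ[PowerSeries.constantCoeff (R := IwasawaAlgebra p)] D.X :=
    (r • (⊤ : Submodule (IwasawaAlgebra₂ p) D₂.X)).liftQ φ (X_smul_top_le_ker_transpose_right hg hφ)
  have hf₀ : ∀ x : D₂.X, f₀ (Submodule.Quotient.mk x) = φ x := fun x ↦ rfl
  -- `Λ`-linear for the `compHom` structure
  let f : QuotSMulTop r D₂.X →ₗ[IwasawaAlgebra p] D.X :=
    { toFun := f₀
      map_add' := f₀.map_add
      map_smul' := fun a q ↦ by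
        change f₀ ((PowerSeries.C a : IwasawaAlgebra₂ p) • q) = a • f₀ q
        rw [f₀.map_smulₛₗ, PowerSeries.constantCoeff_C] }
  have hf : ∀ x : D₂.X, f (Submodule.Quotient.mk x) = φ x := hf₀
  refine ⟨f, fun x t ↦ by rw [hf, hφ], ?_, ?_⟩
  · -- cokernel: `range f` and `range φ` have the same underlying subgroup
    have hrange : (LinearMap.range f).toAddSubgroup = φ.toAddMonoidHom.range := by
      ext y
      simp only [Submodule.mem_toAddSubgroup, LinearMap.mem_range, AddMonoidHom.mem_range, LinearMap.toAddMonoidHom_coe]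
      constructor
      · rintro ⟨q, rfl⟩
        obtain ⟨x, rfl⟩ := Submodule.Quotient.mk_surjective _ q
        exact ⟨x, (hf x).symm⟩
      · rintro ⟨x, rfl⟩
        exact ⟨Submodule.Quotient.mk x, hf x⟩
    obtain ⟨hfin, hle⟩ := finite_coker_transpose_right_and_card_le hg hφ hγ hcont
    let e : D.X ⧸ LinearMap.range f ≃+ D.X ⧸ φ.toAddMonoidHom.range := QuotientAddGroup.quotientAddEquivOfEq hrange
    exact ⟨Finite.of_equiv _ e.toEquiv.symm, (Nat.card_congr e.toEquiv).trans_le hle⟩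
  · -- kernel: `ker f ↪ Hom(I ⧸ g(𝔖), ℚ/ℤ)`
    intro hfinI
    set I : AddSubgroup (unrSelmer₂ κ₁ κ₂ M 𝔮) := (conjSel₂ κ₁ κ₂ M 𝔮 γ₁ - 1).ker with hI
    set R : AddSubgroup I := g.range.addSubgroupOf I with hR
    -- a representative for each class of the kernel
    have hrep : ∀ q : LinearMap.ker f, ∃ x : D₂.X, Submodule.Quotient.mk x = (q : QuotSMulTop r D₂.X) :=
      fun q ↦ Submodule.Quotient.mk_surjective _ _
    choose xr hxr using hrep
    have hvan : ∀ (q : LinearMap.ker f) (t : restrictedSelmerZp κ₂ M 𝔮), D₂.toDual (xr q) (g t) = 0 := fun q t ↦ by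
      have hq : f (q : QuotSMulTop r D₂.X) = 0 := LinearMap.mem_ker.mp q.2
      rw [← hxr q, hf] at hq
      exact (transpose_right_eq_zero_iff hφ (xr q)).mp hq t
    -- the character of `I ⧸ g(𝔖)` attached to a class
    have hkill : ∀ (q : LinearMap.ker f), ∀ i ∈ R, (D₂.toDual (xr q)).comp I.subtype i = 0 := by
      rintro q i hi
      obtain ⟨t, ht⟩ := AddSubgroup.mem_addSubgroupOf.mp hi
      rw [AddMonoidHom.comp_apply, AddSubgroup.coe_subtype, ← ht]
      exact hvan q t
    let Ψ : LinearMap.ker f → (I ⧸ R →+ AddCircle (1 : ℚ)) := fun q ↦ QuotientAddGroup.lift R ((D₂.toDual (xr q)).comp I.subtype) (hkill q)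
    have hΨ : Function.Injective Ψ := by
      intro q q' hqq'
      -- the difference of representatives has a character vanishing on `I`, hence lies in `T₁ D₂.X`
      have hdiff : ∀ s : unrSelmer₂ κ₁ κ₂ M 𝔮, (conjSel₂ κ₁ κ₂ M 𝔮 γ₁ - 1) s = 0 → D₂.toDual (xr q - xr q') s = 0 := by
        intro s hs
        have h1 := DFunLike.congr_fun hqq' (QuotientAddGroup.mk (⟨s, (AddMonoidHom.mem_ker).mpr hs⟩ : I))
        simp only [Ψ, QuotientAddGroup.lift_mk, AddMonoidHom.comp_apply, AddSubgroup.coe_subtype] at h1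
        rw [map_sub, AddMonoidHom.sub_apply, sub_eq_zero]
        exact h1
      obtain ⟨yb, hyb⟩ := IwasawaTwoVariable.exists_comp_eq_of_forall_ker _ _ hdiff
      obtain ⟨y', hy'⟩ := D₂.bijective.2 yb
      have hmem : xr q - xr q' ∈ r • (⊤ : Submodule (IwasawaAlgebra₂ p) D₂.X) := by
        have hx : xr q - xr q' = r • y' := D₂.bijective.1 (by
          ext s
          rw [hyb, AddMonoidHom.comp_apply, hr, IwasawaTwoVariable.toDual_T₁_smul_eq, hy']
          rfl)
        rw [hx]
        exact Submodule.smul_mem_pointwise_smul y' r ⊤ Submodule.mem_top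
      apply Subtype.ext
      rw [← hxr q, ← hxr q', eq_comm, Submodule.Quotient.eq]
      simpa only [neg_sub] using (r • (⊤ : Submodule (IwasawaAlgebra₂ p) D₂.X)).neg_mem hmem
    haveI : Finite (I ⧸ R) := hfinI
    haveI : Finite (I ⧸ R →+ AddCircle (1 : ℚ)) := (PontryaginCard.finite_characterModule_iff (I ⧸ R)).mpr inferInstance
    exact ⟨Finite.of_injective Ψ hΨ,
      (Nat.card_le_card_of_injective Ψ hΨ).trans (PontryaginCard.natCard_characterModule (I ⧸ R)).le⟩

end Generic

/-! ## §3. Road α: the frames (`p = 2`, `κ₁` unramified outside `v`, `κ₂ = κ′` unramified outside `v̄`, `M = W*`) -/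

section Frame

open Summit.BirchSwinnertonDyer.BirchSwinnertonDyer.Theorems.PrintCf2.AdditiveAtSeven

variable {K : Type} [Field K] [NumberField K]

/-- **`W*(K̃_∞)` is finite on every frame, outer convention** (`κ₁` unramified outside `v`, `κ₂` unramified outside `v̄`; the place above `7`
is additive for `W_K`, prime to `2`, unramified in both lines — p682650 §1 with the slots in the LEAD's order).
[cite: Agboola2007, §3 Prop. 3.2] [cite: SilvermanATAEC1994, Thm. IV.10.2(a)] -/
theorem finite_fixedPoints_pairKer_of_frame_right {d : ℤ} (hd0 : d ≠ 0) (W : WeierstrassCurve ℚ) [W.IsElliptic]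
    (C : VariableChange ℚ) (hC : C • W = cm7.quadraticTwist (d : ℚ)) (hK : IsImaginaryQuadratic K)
    (v vbar : HeightOneSpectrum (𝓞 K)) (hv : ((2 : ℕ) : 𝓞 K) ∈ v.asIdeal) (hvbar : ((2 : ℕ) : 𝓞 K) ∈ vbar.asIdeal)
    (π : (W.baseChange K).endRing) (r : ℤ_[2]) (κ₁ κ₂ : ZpExtension K 2) (hκ₁ : κ₁.IsUnramifiedOutside v)
    (hκ₂ : κ₂.IsUnramifiedOutside vbar) :
    Finite (FixedPoints.addSubgroup (ZpExtension.pairKer κ₁ κ₂) ↥((W.baseChange K).endEigenPrimaryTorsion 2 π r)) := by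
  obtain ⟨w, h7⟩ := exists_heightOneSpectrum_natCast_mem (K := K) (q := 7) (by norm_num)
  have h2w : ((2 : ℕ) : 𝓞 K) ∉ w.asIdeal := natCast_two_notMem_of_seven_mem w h7
  have hw₁ : w ≠ v := fun h ↦ h2w (h ▸ hv)
  have hw₂ : w ≠ vbar := fun h ↦ h2w (h ▸ hvbar)
  haveI : (W.baseChange K).IsElliptic := by rw [baseChange]; infer_instance
  exact finite_fixedPoints_pairKer_endEigenPrimaryTorsion_of_hasAdditiveReductionAt (W.baseChange K) π r κ₁ κ₂ hκ₁ hκ₂ hw₁ hw₂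
    h2w (hasAdditiveReductionAt_baseChange_of_j_eq_cm7_of_finrank_eq_two K w hK.1 W (j_eq_of_smul_eq_cm7Twist hd0 W C hC) h7)

/-- **BRICK (RES) ON THE FRAMES, modulo the cokernel of control.** Member `C • W = cm7^{(d)}`, `K` imaginary quadratic, `v`, `v̄` over `2`,
ANY `π, r` (`W* = ↥((W.baseChange K).endEigenPrimaryTorsion 2 π r)`), a generator pair `(κ₁, κ₂; γ₁, γ₂)` with `κ₁` unramified outside `v`
and the LINE `κ₂` unramified outside `v̄`, ANY `Λ₂`-dual datum `D₂` of `H¹_nr(K̃_∞, W*)` and ANY Agboola datum `D` of `𝔖_v̄(K*_∞, W*)`: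
there are the control map `g` (restriction, second slot) and a `Λ`-LINEAR `f : QuotSMulTop T₁ D₂.X →ₗ[Λ] D.X` (`Λ` through `PowerSeries.C`),
transpose of `g`, whose COKERNEL IS FINITE (no hypothesis: `W*(K̃_∞)` is finite) and whose KERNEL IS FINITE with `# ≤ #(I ⧸ g(𝔖))` AS SOON AS
the cokernel of control `I ⧸ g(𝔖)` (`I` = the `γ₁`-invariants of `H¹_nr(K̃_∞, W*)`) is finite — i.e. the TURNKEY's
`restrictedDual_pseudoIso_quotSMulTop_of_frame` with its (RES)(b) input displayed (finite ⟹ pseudo-null over `Λ`, `isPseudoNull_of_finite`).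
[cite: Agboola2007, §3 Prop. 3.2 and §4] [cite: SkinnerUrban2014, Prop. 3.2.8, Cor. 3.2.9 (pp. 23–24)] [cite: GreenbergLNM1716, §3 Lemmas 3.1–3.2] -/
theorem exists_linearMap_quotSMulTop_of_frame {d : ℤ} (hd0 : d ≠ 0) (W : WeierstrassCurve ℚ) [W.IsElliptic]
    (C : VariableChange ℚ) (hC : C • W = cm7.quadraticTwist (d : ℚ)) (hK : IsImaginaryQuadratic K)
    (v vbar : HeightOneSpectrum (𝓞 K)) (hv : ((2 : ℕ) : 𝓞 K) ∈ v.asIdeal) (hvbar : ((2 : ℕ) : 𝓞 K) ∈ vbar.asIdeal)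
    (π : (W.baseChange K).endRing) (r : ℤ_[2]) (κ₁ κ₂ : ZpExtension K 2) (hκ₁ : κ₁.IsUnramifiedOutside v)
    (hκ₂ : κ₂.IsUnramifiedOutside vbar) {γ₁ γ₂ : absoluteGaloisGroup K} (hγ : ZpExtension.IsTopGeneratorPair κ₁ κ₂ γ₁ γ₂)
    (D₂ : DualData₂ κ₁ κ₂ ↥((W.baseChange K).endEigenPrimaryTorsion 2 π r) vbar γ₁ γ₂)
    (D : RestrictedDualData κ₂ ↥((W.baseChange K).endEigenPrimaryTorsion 2 π r) vbar γ₂) :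
    letI : Module (IwasawaAlgebra 2) (QuotSMulTop (PowerSeries.X : IwasawaAlgebra₂ 2) D₂.X) :=
      Module.compHom _ (PowerSeries.C (R := IwasawaAlgebra 2))
    ∃ (g : restrictedSelmerZp κ₂ ↥((W.baseChange K).endEigenPrimaryTorsion 2 π r) vbar →+
        unrSelmer₂ κ₁ κ₂ ↥((W.baseChange K).endEigenPrimaryTorsion 2 π r) vbar)
      (f : QuotSMulTop (PowerSeries.X : IwasawaAlgebra₂ 2) D₂.X →ₗ[IwasawaAlgebra 2] D.X),
      (∀ t, ((g t : unrSelmer₂ κ₁ κ₂ ↥((W.baseChange K).endEigenPrimaryTorsion 2 π r) vbar) :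
          subgroupH1 (ZpExtension.pairKer κ₁ κ₂) ↥((W.baseChange K).endEigenPrimaryTorsion 2 π r)) =
        resOfLe ↥((W.baseChange K).endEigenPrimaryTorsion 2 π r) (ZpExtension.pairKer_le_right κ₁ κ₂)
          (t : subgroupH1 κ₂.kerSubgroup ↥((W.baseChange K).endEigenPrimaryTorsion 2 π r))) ∧
      (∀ (x : D₂.X) (t : restrictedSelmerZp κ₂ ↥((W.baseChange K).endEigenPrimaryTorsion 2 π r) vbar),
          D.toDual (f (Submodule.Quotient.mk x)) t = D₂.toDual x (g t)) ∧
      (Finite (D.X ⧸ LinearMap.range f) ∧ Module.IsPseudoNull (IwasawaAlgebra 2) (D.X ⧸ LinearMap.range f)) ∧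
      (Finite ((conjSel₂ κ₁ κ₂ ↥((W.baseChange K).endEigenPrimaryTorsion 2 π r) vbar γ₁ - 1).ker ⧸
          g.range.addSubgroupOf (conjSel₂ κ₁ κ₂ ↥((W.baseChange K).endEigenPrimaryTorsion 2 π r) vbar γ₁ - 1).ker) →
        Finite (LinearMap.ker f) ∧ Module.IsPseudoNull (IwasawaAlgebra 2) (LinearMap.ker f) ∧
          Nat.card (LinearMap.ker f) ≤
            Nat.card ((conjSel₂ κ₁ κ₂ ↥((W.baseChange K).endEigenPrimaryTorsion 2 π r) vbar γ₁ - 1).ker ⧸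
              g.range.addSubgroupOf (conjSel₂ κ₁ κ₂ ↥((W.baseChange K).endEigenPrimaryTorsion 2 π r) vbar γ₁ - 1).ker)) := by
  refine (exists_lineRes_right κ₁ κ₂ ↥((W.baseChange K).endEigenPrimaryTorsion 2 π r) vbar).elim fun g hg ↦ ?_
  have htor : ∀ m : ↥((W.baseChange K).endEigenPrimaryTorsion 2 π r), ∃ k : ℕ, 2 ^ k • m = 0 :=
    exists_pow_smul_endEigenPrimaryTorsion_eq_zero (W.baseChange K) 2 π r
  have hstab : ∀ m : ↥((W.baseChange K).endEigenPrimaryTorsion 2 π r),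
      IsOpen (MulAction.stabilizer (absoluteGaloisGroup K) m : Set (absoluteGaloisGroup K)) :=
    isOpen_stabilizer_endEigenPrimaryTorsion (W.baseChange K) 2 π r
  have hcont : ∀ m : ↥((W.baseChange K).endEigenPrimaryTorsion 2 π r), Continuous fun σ : absoluteGaloisGroup K ↦ σ • m :=
    continuous_smul_endEigenPrimaryTorsion (W.baseChange K) 2 π r
  haveI hF : Finite (FixedPoints.addSubgroup (ZpExtension.pairKer κ₁ κ₂) ↥((W.baseChange K).endEigenPrimaryTorsion 2 π r)) :=
    finite_fixedPoints_pairKer_of_frame_right hd0 W C hC hK v vbar hv hvbar π r κ₁ κ₂ hκ₁ hκ₂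
  haveI : Finite (FixedPoints.addSubgroup (ZpExtension.pairKer κ₁ κ₂) ↥((W.baseChange K).endEigenPrimaryTorsion 2 π r) ⧸
      (ResKernel.subOne (ZpExtension.pairKer κ₁ κ₂) ↥((W.baseChange K).endEigenPrimaryTorsion 2 π r) γ₁).range) := inferInstance
  refine (exists_transpose_right hg hγ htor hstab D₂ D).elim fun φ hφ ↦ ?_
  refine (exists_linearMap_quotSMulTop hg hφ hγ hcont).elim fun f hf ↦ ?_
  refine ⟨g, f, hg, hf.1, ⟨hf.2.1.1, ?_⟩, fun hfinI ↦ ?_⟩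
  · haveI := hf.2.1.1
    exact isPseudoNull_of_finite 2 _
  · have hk := hf.2.2 hfinI
    haveI := hk.1
    exact ⟨hk.1, isPseudoNull_of_finite 2 _, hk.2⟩

end Frame

end Summit.BirchSwinnertonDyer.BirchSwinnertonDyer.Theorems.PrintCf2.LinePush
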